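import Literature.Computability.QuantumComplexity.OraclePathSums
import Literature.Computability.Complexity.GapNatPSpace
import HarnessLib

/-!
# The exact `√2`-threshold tests of path-pair counts are `PSPACE` predicates of `GapNatPSPACE` counts

Topic `Literature/Computability/QuantumComplexity`, joining `OraclePathSums.lean` (the integer tests
`posSqrtTwoTest a b ↔ 0 < a + b√2`, `StateVectorDP.lean`, and
`linFormTest c₀ c₁ c₂ A₁ B₁ A₂ B₂ ↔ 0 < c₁(A₁ + (√2/2)B₁) + c₂(A₂ + (√2/2)B₂) + c₀`, by which the heavy-query
test `1/a ≤ W(S)` and the sampling comparisons `j < M·W(S)` of Clifford+`T` query circuits are decided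
EXACTLY from the pair counts `A_S, B_S`, `2^h W(S) = A_S + (√2/2) B_S`) with the counting calculus of
`Complexity/GapNatPSpace.lean` (Ladner's `♮PSPACE` and its gap closure `GapNatPSPACE`: ring operations,
`pos_mem_PSPACE`, `setOf_lt_mem_PSPACE`). When the counts are `GapNatPSPACE` functions of the input —
as the pair counts of the replaced circuits of Aaronson–Chen's Lemma 5.3 are, being sums over pairs of
guessed paths whose admissibility is a `PSPACE` predicate (CCC 2017, §5.3 p. 23: "all the computations
can be done in `PSPACE`") — the tests are `PSPACE` predicates: `posSqrtTwoTest` is a Boolean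
combination of sign conditions on `a`, `b`, `a²`, `2b²`, all in `GapNatPSPACE`, and `PSPACE` is closed
under complement, and under union and intersection (two-query truth tables to a complete language,
`PSpaceClosure.lean`).

* `posSqrtTwoTest_eq_true_iff_int` — the test as integer sign conditions;
* **`setOf_posSqrtTwoTest_mem_PSPACE`** — `{x | posSqrtTwoTest (a x) (b x)} ∈ PSPACE` for
  `a, b ∈ GapNatPSPACE`; `setOf_posSqrtTwoTest_eq_false_mem_PSPACE`;
* **`setOf_linFormTest_mem_PSPACE`**, **`setOf_linFormTest_eq_false_mem_PSPACE`** — the linear-form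
  test (and its failure, the form of the heavy-query test `le_annWeight_iff`) on seven
  `GapNatPSPACE` functions.

## References

* S. Aaronson, L. Chen, *Complexity-theoretic foundations of quantum supremacy experiments*,
  CCC 2017 (arXiv:1612.05903), §5.3 (pp. 22–23) [AaronsonChen2017].
* S. Fenner, L. Fortnow, S. Kurtz, *Gap-definable counting classes*, JCSS 48 (1994), §3,
  Prop. 4.2 (closure and thresholds of gap classes; relativizing), as in `GapNatPSpace.lean`
  [FennerFortnowKurtz1994].
* R. E. Ladner, *Polynomial space counting problems*, SIAM J. Comput. 18 (1989), §1 [Ladner1989].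
-/

noncomputable section

namespace Literature.Computability.QuantumComplexity

open _root_.Computability Complexity

/-- **The `√2` sign test as integer sign conditions**: `posSqrtTwoTest a b` holds iff
`(0 < a ∧ (0 ≤ b ∨ 2b² < a²)) ∨ (a ≤ 0 ∧ 0 ≤ b ∧ a² < 2b²)`. [folklore] -/
theorem posSqrtTwoTest_eq_true_iff_int (a b : ℤ) :
    posSqrtTwoTest a b = true ↔
      (0 < a ∧ (0 ≤ b ∨ 2 * b * b < a * a)) ∨ (a ≤ 0 ∧ 0 ≤ b ∧ a * a < 2 * b * b) := by
  simp only [posSqrtTwoTest, Bool.or_eq_true, Bool.and_eq_true, decide_eq_true_eq]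

variable {a b : List Bool → ℤ}

/-- **The `√2` sign test of two `GapNatPSPACE` functions is a `PSPACE` predicate.**
[cite: FennerFortnowKurtz1994, Proposition 4.2] [cite: AaronsonChen2017, §5.3 (p. 23, "all the computations can be done in PSPACE")] -/
theorem setOf_posSqrtTwoTest_mem_PSPACE (ha : a ∈ GapNatPSPACE) (hb : b ∈ GapNatPSPACE) :
    {x | posSqrtTwoTest (a x) (b x) = true} ∈ PSPACE := by
  obtain ⟨B, hB⟩ := exists_isComplete_PSPACE_holds
  have haa : (fun x => a x * a x) ∈ GapNatPSPACE := mul_mem_GapNatPSPACE ha ha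
  have hbb : (fun x => 2 * b x * b x) ∈ GapNatPSPACE := mul_mem_GapNatPSPACE (zsmul_mem_GapNatPSPACE 2 hb) hb
  have h1 : {x | 0 < a x} ∈ PSPACE := pos_mem_PSPACE ha
  have h2 : {x | 0 ≤ b x} ∈ PSPACE := nonneg_mem_PSPACE hb
  have h3 : {x | 2 * b x * b x < a x * a x} ∈ PSPACE := setOf_lt_mem_PSPACE hbb haa
  have h4 : {x | a x ≤ 0} ∈ PSPACE := nonpos_mem_PSPACE ha
  have h5 : {x | a x * a x < 2 * b x * b x} ∈ PSPACE := setOf_lt_mem_PSPACE haa hbb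
  have h := union_mem_PSPACE_of_complete hB
    (inter_mem_PSPACE_of_complete hB h1 (union_mem_PSPACE_of_complete hB h2 h3))
    (inter_mem_PSPACE_of_complete hB h4 (inter_mem_PSPACE_of_complete hB h2 h5))
  refine mem_PSPACE_of_iff' h _ fun x => ?_
  change posSqrtTwoTest (a x) (b x) = true ↔
    (0 < a x ∧ (0 ≤ b x ∨ 2 * b x * b x < a x * a x)) ∨ (a x ≤ 0 ∧ (0 ≤ b x ∧ a x * a x < 2 * b x * b x))
  exact posSqrtTwoTest_eq_true_iff_int _ _

/-- The failure of the `√2` sign test is a `PSPACE` predicate (complement). [folklore] -/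
theorem setOf_posSqrtTwoTest_eq_false_mem_PSPACE (ha : a ∈ GapNatPSPACE) (hb : b ∈ GapNatPSPACE) :
    {x | posSqrtTwoTest (a x) (b x) = false} ∈ PSPACE := by
  refine mem_PSPACE_of_iff' (compl_mem_PSPACE (setOf_posSqrtTwoTest_mem_PSPACE ha hb)) _ fun x => ?_
  change posSqrtTwoTest (a x) (b x) = false ↔ ¬ posSqrtTwoTest (a x) (b x) = true
  exact Bool.eq_false_iff

variable {c₀ c₁ c₂ A₁ B₁ A₂ B₂ : List Bool → ℤ}

/-- The two arguments of `linFormTest` are `GapNatPSPACE` functions of its seven inputs. [folklore] -/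
theorem linFormArgs_mem_GapNatPSPACE (h₀ : c₀ ∈ GapNatPSPACE) (h₁ : c₁ ∈ GapNatPSPACE) (h₂ : c₂ ∈ GapNatPSPACE)
    (hA₁ : A₁ ∈ GapNatPSPACE) (hB₁ : B₁ ∈ GapNatPSPACE) (hA₂ : A₂ ∈ GapNatPSPACE) (hB₂ : B₂ ∈ GapNatPSPACE) :
    (fun x => 2 * (c₁ x * A₁ x + c₂ x * A₂ x + c₀ x)) ∈ GapNatPSPACE ∧
      (fun x => c₁ x * B₁ x + c₂ x * B₂ x) ∈ GapNatPSPACE :=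
  ⟨zsmul_mem_GapNatPSPACE 2 (add_mem_GapNatPSPACE (add_mem_GapNatPSPACE (mul_mem_GapNatPSPACE h₁ hA₁)
      (mul_mem_GapNatPSPACE h₂ hA₂)) h₀),
    add_mem_GapNatPSPACE (mul_mem_GapNatPSPACE h₁ hB₁) (mul_mem_GapNatPSPACE h₂ hB₂)⟩

/-- **The linear-form test on `GapNatPSPACE` coefficients and pair counts is a `PSPACE` predicate**
(the sampling comparisons `mul_annWeight_lt_iff`, `lt_mul_annWeight_iff` of Aaronson–Chen's simulator).
[cite: AaronsonChen2017, §5.3 (p. 23, "it first takes a sample z by measuring |v_{T+1}⟩"; "all the computations can be done in PSPACE")] [cite: FennerFortnowKurtz1994, Proposition 4.2] -/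
theorem setOf_linFormTest_mem_PSPACE (h₀ : c₀ ∈ GapNatPSPACE) (h₁ : c₁ ∈ GapNatPSPACE) (h₂ : c₂ ∈ GapNatPSPACE)
    (hA₁ : A₁ ∈ GapNatPSPACE) (hB₁ : B₁ ∈ GapNatPSPACE) (hA₂ : A₂ ∈ GapNatPSPACE) (hB₂ : B₂ ∈ GapNatPSPACE) :
    {x | linFormTest (c₀ x) (c₁ x) (c₂ x) (A₁ x) (B₁ x) (A₂ x) (B₂ x) = true} ∈ PSPACE := by
  obtain ⟨hu, hv⟩ := linFormArgs_mem_GapNatPSPACE h₀ h₁ h₂ hA₁ hB₁ hA₂ hB₂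
  exact mem_PSPACE_of_iff' (setOf_posSqrtTwoTest_mem_PSPACE hu hv) _ fun x => Iff.rfl

/-- **The failure of the linear-form test is a `PSPACE` predicate** (the heavy-query test
`1/a ≤ W(S)`, `le_annWeight_iff`, of Aaronson–Chen's simulator: "we query all `x` with `Q(x) ≥ τ`").
[cite: AaronsonChen2017, §5.3 (p. 22, "Construction and Analysis of g"; p. 23)] [cite: FennerFortnowKurtz1994, Proposition 4.2] -/
theorem setOf_linFormTest_eq_false_mem_PSPACE (h₀ : c₀ ∈ GapNatPSPACE) (h₁ : c₁ ∈ GapNatPSPACE)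
    (h₂ : c₂ ∈ GapNatPSPACE) (hA₁ : A₁ ∈ GapNatPSPACE) (hB₁ : B₁ ∈ GapNatPSPACE) (hA₂ : A₂ ∈ GapNatPSPACE)
    (hB₂ : B₂ ∈ GapNatPSPACE) :
    {x | linFormTest (c₀ x) (c₁ x) (c₂ x) (A₁ x) (B₁ x) (A₂ x) (B₂ x) = false} ∈ PSPACE := by
  obtain ⟨hu, hv⟩ := linFormArgs_mem_GapNatPSPACE h₀ h₁ h₂ hA₁ hB₁ hA₂ hB₂
  exact mem_PSPACE_of_iff' (setOf_posSqrtTwoTest_eq_false_mem_PSPACE hu hv) _ fun x => Iff.rfl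

end Literature.Computability.QuantumComplexity

end
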